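/-
Copyright (c) 2026 the pub-hodgecm-mathlib formalisation cell (harness21).  Prover seat hodgecm-mathlib-K2E3-p23 (g3), Track B «K2-LIT» ∕ h413
(`stmt-HodgeConjecture-24833`), line `K2_E3_EllipticInputs`, 13a road A (line lead K2E3-p10 (g3)), item (D2) «Witt–Iwasawa for a normalised
anisotropic kernel», file F1.  2026-09-04.
-/
import Summits.HodgeConjecture.HodgeConjecture.Theorems.K2E3WittParabolicBlocks      -- ★ p856547 (K2E3-p10): rows of `W = wittFormOn e Han`, ★ `rev_apply_inl`
import Literature.NumberTheory.Automorphic.UnitaryGroupIsotropicFrameChart            -- ★ `hermForm_sum_left ∕ right`, ★ `UnitaryGroupIsotropicLineElements` (algebra of `hermForm`)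
import Literature.NumberTheory.Automorphic.HyperspecialUnitaryIwasawa                 -- ★ `stdLattice`, `frame`, `exists_inv_smul_mem_stdLattice`
import Literature.NumberTheory.Automorphic.HermitianLatticesLocal                     -- ★ `HermitianLattice.v_lt_one_iff`
import HarnessLib

/-!
# Crux `H413` — K2-LIT E3 «EllipticInputs», 13a road A, item (D2) F1: the hermitian pairing of a Witt form `W = wittFormOn e Han` in a STANDARD
# indexing — hyperbolic rows, the split `h_W = (hyperbolic part) + h_an`, hermitian-ness and integrality from the kernel, and
# «a primitive isotropic vector of `𝒪^N` has a UNIT HYPERBOLIC coordinate» for a NORMALISED anisotropic kernel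

Cell `hodgecm-mathlib`, Track B «K2-LIT», crux item `stmt-HodgeConjecture-24833` (h413), socket U12-g ‹13a› road A (Jacquet's admissibility theorem for
`U_N(H)(L⁺_v)` via the Witt parabolic system of K2E3-p10).  Item (D2) of the lead's RULINGS #8∕#9 (K2 bus 2026-09-04T01:34:38Z ∕ 01:38:30Z): the
Iwasawa decomposition `U(σ, W)(K) = P_∅ · K₀`, `K₀ = U(σ, W) ∩ GL_N(𝒪)` (★ `unitaryInt`), for a Witt form `W = wittFormOn e Han` with an anisotropic
kernel `Han` of ANY size `m` which is NORMALISED — integral, with maximal lattice `{z | |h_an(z,z)| ≤ 1} = 𝒪^m` (such kernels exist in every class: ★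
`HermitianLattice.exists_formCongr_maximalLattice_eq_stdLattice`, p856519).  This file is the form-level bookkeeping (F1 of 3); F2 = `K₀` is transitive on
primitive isotropic vectors, F3 = the flag induction and `U = P_S · K₀`.

SETTING.  `K` a field with `Valued K ℤᵐ⁰`, `σ : K →+* K`; `e : WittIndex r m ≃ Fin N` a STANDARD indexing (`hstd`: `e_i ↦ i`, kernel `u ↦ r + u`,
`f`-slot `j ↦ r + m + j`), so that `Fin.rev` exchanges `e_i` with its partner slot (★ `rev_apply_inl`) and preserves the kernel block as a set;
a position `a : Fin N` is HYPERBOLIC when `a.val < r ∨ r + m ≤ a.val`.  `h_W = hermForm σ (wittFormOn e Han)`, `𝒪^N = stdLattice K N`.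

* §1 positions: `eq_apply_inl_of_lt`, `eq_apply_inr_inr_of_le`, `eq_apply_inr_inl_of`, `rev_hyperbolic`, `wittFormOn_apply_of_hyperbolic` (row `a` of
  `W` is `[q = rev a]`), `wittFormOn_apply_of_hyperbolic'` (column), `wittFormOn_kernel_hyperbolic` (`W u a = 0`).
* §2 the pairing: `hermForm_single_left` (`h_H(e_a, v) = (H v)_a`, any `H`), **`hermForm_witt_single_left ∕ right`** (`h_W(e_a, v) = v (rev a)`,
  `h_W(v, e_a) = σ (v (rev a))` for hyperbolic `a`), `hermForm_witt_single_single_of_hyperbolic` (`h_W(e_a, e_a) = 0`), **`hermForm_witt_eq_sum_add`**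
  (`h_W x y = Σ_i (σ x_{e_i} y_{f_i} + σ x_{f_i} y_{e_i}) + h_an(x_mid, y_mid)`), `transpose_map_wittFormOn` (`W` is `σ`-hermitian when `Han` is),
  `v_wittFormOn_apply_le_one` (`W` is integral when `Han` is), `v_hermForm_le_one_of_mem_stdLattice` (an integral form is `𝒪`-valued on `𝒪^N`).
* §3 **`exists_v_eq_one_hyperbolic`**: `hvσ`, `hϖ : v ϖ = exp (−1)`, `Han` NORMALISED (`hmax : |h_an(z,z)| ≤ 1 → z ∈ 𝒪^m`): an isotropic `x ∈ 𝒪^N`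
  with a unit coordinate has a unit coordinate at a HYPERBOLIC position — if all hyperbolic coordinates lie in `𝔭` the hyperbolic part of
  `h_W(x,x) = 0` lies in `𝔭²`, so `|h_an(x_mid, x_mid)| ≤ |ϖ|²`, `ϖ⁻¹ x_mid ∈ 𝒪^m` by `hmax`, and every coordinate of `x` lies in `𝔭`.

`--supports stmt-HodgeConjecture-24833 --as helper`.  THEOREMS ONLY — no `def`, no named fact, no instance, no notation, no `sorry`.  HONEST LABEL: HC_CM is
proved only modulo the 7 printed citations (2 remaining named inputs: hLiu418 = stmt-HodgeConjecture-24832, h413 = stmt-HodgeConjecture-24833) until rung 0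
closes; this file is unconditional local algebra and closes no organ by itself.

## References
* [BruhatTits1972] F. Bruhat, J. Tits, *Groupes réductifs sur un corps local I*, Publ. Math. IHÉS 41 (1972), (4.4.3).
* [Tits1979] J. Tits, *Reductive groups over local fields*, Proc. Symp. Pure Math. 33.1 (1979), §3.3.2–§3.3.3.
* [Omeara1963] O. T. O'Meara, *Introduction to Quadratic Forms* (1963), §81A, §82F, §91A.
* [Jacobowitz1962] R. Jacobowitz, *Hermitian forms over local fields*, Amer. J. Math. 84 (1962), §4.
* [Dieudonne1971GroupesClassiques] J. Dieudonné, *La géométrie des groupes classiques*, 3e éd. (1971), Chap. I §11.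
-/

set_option autoImplicit false
-- the mandated namespace repeats `HodgeConjecture.HodgeConjecture`, as in every `Theorems/*.lean` of this sub-problem
set_option linter.dupNamespace false

noncomputable section

open scoped Matrix MatrixGroups Valued WithZero
open Matrix

namespace Summit.HodgeConjecture.HodgeConjecture.Cruxes.H413.K2E3WittHermFormStd

open Literature.NumberTheory.Automorphic Literature.NumberTheory.Automorphic.UnitaryGroup Literature.NumberTheory.Automorphic.HermitianLattice
open K2E3LocalUnitaryWitt K2E3WittCartanUnramified K2E3WittParabolicBlocks

/-! ## §1 Positions of a standard indexing: `e`-indices, kernel, `f`-slots; hyperbolic rows of `W` -/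

section Positions

variable {R : Type*} [CommRing R] {N r m : ℕ} (e : WittIndex r m ≃ Fin N)
  (hstd : ∀ x, (e x).val = Sum.elim (fun i : Fin r => i.val) (Sum.elim (fun u : Fin m => r + u.val) (fun j : Fin r => r + m + j.val)) x)
  (Han : Matrix (Fin m) (Fin m) R)

omit [CommRing R] in
include e in
/-- `N = r + (m + r)` for a Witt indexing of `Fin N`. [cite: Dieudonne1971GroupesClassiques, Chap. I §11] -/
theorem card_eq : N = r + (m + r) := by simpa using (Fintype.card_congr e).symm

include hstd in
/-- A position `a < r` is the `e`-index `e_a`. [cite: Borel1991, §23] -/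
theorem eq_apply_inl_of_lt {a : Fin N} (ha : a.val < r) : a = e (Sum.inl ⟨a.val, ha⟩) :=
  Fin.ext (by rw [hstd]; rfl)

include hstd in
/-- A position `a ≥ r + m` is the `f`-slot `a − (r + m)`. [cite: Borel1991, §23] -/
theorem eq_apply_inr_inr_of_le {a : Fin N} (ha : r + m ≤ a.val) :
    a = e (Sum.inr (Sum.inr ⟨a.val - (r + m), by have := a.isLt; have := card_eq e; omega⟩)) :=
  Fin.ext (by rw [hstd]; simp only [Sum.elim_inr]; omega)

include hstd in
/-- A position `r ≤ a < r + m` is the kernel index `a − r`. [cite: Borel1991, §23] -/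
theorem eq_apply_inr_inl_of {a : Fin N} (h₁ : r ≤ a.val) (h₂ : a.val < r + m) :
    a = e (Sum.inr (Sum.inl ⟨a.val - r, by omega⟩)) :=
  Fin.ext (by rw [hstd]; simp only [Sum.elim_inr, Sum.elim_inl]; omega)

include hstd in
/-- `e_i` sits at a hyperbolic position (`< r`). [cite: Borel1991, §23] -/
theorem apply_inl_hyperbolic (i : Fin r) : (e (Sum.inl i)).val < r ∨ r + m ≤ (e (Sum.inl i)).val := Or.inl (by rw [hstd]; exact i.isLt)

include hstd in
/-- An `f`-slot sits at a hyperbolic position (`≥ r + m`). [cite: Borel1991, §23] -/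
theorem apply_inr_inr_hyperbolic (j : Fin r) : (e (Sum.inr (Sum.inr j))).val < r ∨ r + m ≤ (e (Sum.inr (Sum.inr j))).val :=
  Or.inr (by rw [hstd]; simp only [Sum.elim_inr]; omega)

include hstd in
/-- A kernel index sits at a non-hyperbolic position. [cite: Borel1991, §23] -/
theorem apply_inr_inl_not_hyperbolic (u : Fin m) : ¬((e (Sum.inr (Sum.inl u))).val < r ∨ r + m ≤ (e (Sum.inr (Sum.inl u))).val) := by
  rw [hstd]; simp only [Sum.elim_inr, Sum.elim_inl]; omega

include e in
/-- `rev` of a hyperbolic position is hyperbolic (`rev a = N − 1 − a`, `N = 2r + m`). [cite: Borel1991, §23] -/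
theorem rev_hyperbolic {a : Fin N} (ha : a.val < r ∨ r + m ≤ a.val) : (Fin.rev a).val < r ∨ r + m ≤ (Fin.rev a).val := by
  have hN := card_eq e; have := a.isLt; rw [Fin.val_rev]; omega

include e in
/-- A hyperbolic position is moved by `rev`. [cite: Borel1991, §23] -/
theorem rev_ne_of_hyperbolic {a : Fin N} (ha : a.val < r ∨ r + m ≤ a.val) : Fin.rev a ≠ a := by
  intro h; have h' := congrArg Fin.val h; have hN := card_eq e; have := a.isLt; rw [Fin.val_rev] at h'; omega

include e in
/-- `rev` of a kernel position is a kernel position. [cite: Borel1991, §23] -/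
theorem rev_kernel {a : Fin N} (h₁ : r ≤ a.val) (h₂ : a.val < r + m) : r ≤ (Fin.rev a).val ∧ (Fin.rev a).val < r + m := by
  have hN := card_eq e; have := a.isLt; rw [Fin.val_rev]; omega

include hstd in
/-- **Row `a` of `W` at a hyperbolic position is `[q = rev a]`** (★ `wittFormOn_apply_inl ∕ inr_inr`). [cite: Dieudonne1971GroupesClassiques, Chap. I §11] -/
theorem wittFormOn_apply_of_hyperbolic {a : Fin N} (ha : a.val < r ∨ r + m ≤ a.val) (q : Fin N) :
    wittFormOn e Han a q = if q = Fin.rev a then 1 else 0 := by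
  rcases ha with ha | ha
  · conv_lhs => rw [eq_apply_inl_of_lt e hstd ha]
    rw [wittFormOn_apply_inl e hstd Han, ← eq_apply_inl_of_lt e hstd ha]
  · conv_lhs => rw [eq_apply_inr_inr_of_le e hstd ha]
    rw [wittFormOn_apply_inr_inr e hstd Han, ← eq_apply_inr_inr_of_le e hstd ha]

include hstd in
/-- **Column `a` of `W` at a hyperbolic position is `[p = rev a]`** (★ `wittFormOn_apply_comm_inl ∕ inr_inr`). [cite: Dieudonne1971GroupesClassiques, Chap. I §11] -/
theorem wittFormOn_apply_of_hyperbolic' {a : Fin N} (ha : a.val < r ∨ r + m ≤ a.val) (p : Fin N) :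
    wittFormOn e Han p a = if p = Fin.rev a then 1 else 0 := by
  rcases ha with ha | ha
  · conv_lhs => rw [eq_apply_inl_of_lt e hstd ha]
    rw [wittFormOn_apply_comm_inl, wittFormOn_apply_inl e hstd Han, ← eq_apply_inl_of_lt e hstd ha]
  · conv_lhs => rw [eq_apply_inr_inr_of_le e hstd ha]
    rw [wittFormOn_apply_comm_inr_inr, wittFormOn_apply_inr_inr e hstd Han, ← eq_apply_inr_inr_of_le e hstd ha]

include hstd in
/-- `W u a = 0` for `u` a kernel position and `a` hyperbolic (the kernel is `W`-orthogonal to the hyperbolic frame). [cite: Dieudonne1971GroupesClassiques, Chap. I §11] -/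
theorem wittFormOn_kernel_hyperbolic {u a : Fin N} (h₁ : r ≤ u.val) (h₂ : u.val < r + m) (ha : a.val < r ∨ r + m ≤ a.val) :
    wittFormOn e Han u a = 0 := by
  rw [wittFormOn_apply_of_hyperbolic' e hstd Han ha, if_neg]
  intro h
  have h3 := rev_hyperbolic e ha
  rw [← h] at h3
  omega

include hstd in
/-- `W a u = 0` for `a` hyperbolic and `u` a kernel position. [cite: Dieudonne1971GroupesClassiques, Chap. I §11] -/
theorem wittFormOn_hyperbolic_kernel {u a : Fin N} (h₁ : r ≤ u.val) (h₂ : u.val < r + m) (ha : a.val < r ∨ r + m ≤ a.val) :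
    wittFormOn e Han a u = 0 := by
  rw [wittFormOn_apply_of_hyperbolic e hstd Han ha, if_neg]
  intro h
  have h3 := rev_hyperbolic e ha
  rw [← h] at h3
  omega

include hstd in
/-- `W u u′ = Han (u − r) (u′ − r)` on the kernel block. [cite: Dieudonne1971GroupesClassiques, Chap. I §11] -/
theorem wittFormOn_kernel_kernel {u u' : Fin N} (h₁ : r ≤ u.val) (h₂ : u.val < r + m) (h₁' : r ≤ u'.val) (h₂' : u'.val < r + m) :
    wittFormOn e Han u u' = Han ⟨u.val - r, by omega⟩ ⟨u'.val - r, by omega⟩ := by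
  conv_lhs => rw [eq_apply_inr_inl_of e hstd h₁ h₂, eq_apply_inr_inl_of e hstd h₁' h₂']
  rw [wittFormOn_apply, e.symm_apply_apply, e.symm_apply_apply, wittForm_inr_inl_inr_inl]

end Positions

/-! ## §2 The pairing `h_W = hermForm σ W` in a standard indexing -/

section Pairing

variable {R : Type*} [CommRing R] (σ : R →+* R) {N r m : ℕ} (e : WittIndex r m ≃ Fin N)
  (hstd : ∀ x, (e x).val = Sum.elim (fun i : Fin r => i.val) (Sum.elim (fun u : Fin m => r + u.val) (fun j : Fin r => r + m + j.val)) x)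
  (Han : Matrix (Fin m) (Fin m) R)

/-- `h_H(e_a, v) = (H v)_a` for ANY form matrix `H` (`σ` fixes the coordinates `0, 1` of `e_a`). [cite: Dieudonne1971GroupesClassiques, Chap. I §11] -/
theorem hermForm_single_left {n : Type*} [Fintype n] [DecidableEq n] (H : Matrix n n R) (a : n) (v : n → R) :
    hermForm σ H (Pi.single a 1) v = (H *ᵥ v) a := by
  have h1 : (⇑σ ∘ Pi.single a (1 : R) : n → R) = Pi.single a 1 := by
    funext k
    by_cases hk : k = a
    · subst hk; simp
    · simp [Pi.single_eq_of_ne hk]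
  rw [hermForm_apply, h1, single_one_dotProduct]

/-- `h_H(v, e_a) = Σ_p σ(v_p) H_{p a}` for ANY form matrix `H`. [cite: Dieudonne1971GroupesClassiques, Chap. I §11] -/
theorem hermForm_single_right {n : Type*} [Fintype n] [DecidableEq n] (H : Matrix n n R) (v : n → R) (a : n) :
    hermForm σ H v (Pi.single a 1) = ∑ p, σ (v p) * H p a := by
  rw [hermForm_apply, Matrix.mulVec_single_one]
  simp only [dotProduct, Function.comp_apply, Matrix.col_apply]

include hstd in
/-- **`h_W(e_a, v) = v (rev a)` at a hyperbolic position `a`.** [cite: Dieudonne1971GroupesClassiques, Chap. I §11] [cite: Tits1979, §3.3.3] -/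
theorem hermForm_witt_single_left {a : Fin N} (ha : a.val < r ∨ r + m ≤ a.val) (v : Fin N → R) :
    hermForm σ (wittFormOn e Han) (Pi.single a 1) v = v (Fin.rev a) := by
  rw [hermForm_single_left, Matrix.mulVec, dotProduct, Finset.sum_eq_single (Fin.rev a)]
  · rw [wittFormOn_apply_of_hyperbolic e hstd Han ha, if_pos rfl, one_mul]
  · intro q _ hq; rw [wittFormOn_apply_of_hyperbolic e hstd Han ha, if_neg hq, zero_mul]
  · intro h; exact absurd (Finset.mem_univ _) h

include hstd in
/-- **`h_W(v, e_a) = σ (v (rev a))` at a hyperbolic position `a`.** [cite: Dieudonne1971GroupesClassiques, Chap. I §11] [cite: Tits1979, §3.3.3] -/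
theorem hermForm_witt_single_right {a : Fin N} (ha : a.val < r ∨ r + m ≤ a.val) (v : Fin N → R) :
    hermForm σ (wittFormOn e Han) v (Pi.single a 1) = σ (v (Fin.rev a)) := by
  rw [hermForm_single_right, Finset.sum_eq_single (Fin.rev a)]
  · rw [wittFormOn_apply_of_hyperbolic' e hstd Han ha, if_pos rfl, mul_one]
  · intro p _ hp; rw [wittFormOn_apply_of_hyperbolic' e hstd Han ha, if_neg hp, mul_zero]
  · intro h; exact absurd (Finset.mem_univ _) h

include hstd in
/-- `h_W(e_a, e_a) = 0` at a hyperbolic position (`rev a ≠ a`). [cite: Tits1979, §3.3.3] -/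
theorem hermForm_witt_single_single_of_hyperbolic {a : Fin N} (ha : a.val < r ∨ r + m ≤ a.val) :
    hermForm σ (wittFormOn e Han) (Pi.single a 1) (Pi.single a (1 : R)) = 0 := by
  rw [hermForm_witt_single_left σ e hstd Han ha, Pi.single_eq_of_ne (rev_ne_of_hyperbolic e ha)]

include hstd in
/-- **The split `h_W x y = Σ_i (σ(x_{e_i}) y_{rev e_i} + σ(x_{f_i}) y_{rev f_i}) + h_an(x_mid, y_mid)`** (`x_mid u = x (e u)` on the kernel block).
[cite: Dieudonne1971GroupesClassiques, Chap. I §11] -/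
theorem hermForm_witt_eq_sum_add (x y : Fin N → R) :
    hermForm σ (wittFormOn e Han) x y =
      (∑ i : Fin r, (σ (x (e (Sum.inl i))) * y (Fin.rev (e (Sum.inl i))) +
        σ (x (e (Sum.inr (Sum.inr i)))) * y (Fin.rev (e (Sum.inr (Sum.inr i)))))) +
      hermForm σ Han (fun u => x (e (Sum.inr (Sum.inl u)))) (fun u => y (e (Sum.inr (Sum.inl u)))) := by
  -- row sums of `W *ᵥ y`
  have hrow : ∀ {a : Fin N}, (a.val < r ∨ r + m ≤ a.val) → (wittFormOn e Han *ᵥ y) a = y (Fin.rev a) := fun {a} ha => by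
    rw [← hermForm_single_left σ, hermForm_witt_single_left σ e hstd Han ha]
  have hmid : ∀ u : Fin m, (wittFormOn e Han *ᵥ y) (e (Sum.inr (Sum.inl u))) = (Han *ᵥ fun u' => y (e (Sum.inr (Sum.inl u')))) u := fun u => by
    rw [Matrix.mulVec, Matrix.mulVec, dotProduct, dotProduct, ← e.sum_comp, Fintype.sum_sum_type, Fintype.sum_sum_type]
    simp only [wittFormOn_apply, Equiv.symm_apply_apply, wittForm_inr_inl_inl, wittForm_inr_inl_inr_inl, wittForm_inr_inl_inr_inr, zero_mul,
      Finset.sum_const_zero, zero_add, add_zero]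
  rw [hermForm_apply, dotProduct, ← e.sum_comp, Fintype.sum_sum_type, Fintype.sum_sum_type, hermForm_apply, dotProduct]
  simp only [Function.comp_apply, hrow (apply_inl_hyperbolic e hstd _), hrow (apply_inr_inr_hyperbolic e hstd _), hmid]
  rw [Finset.sum_add_distrib]
  abel

/-- **`W` is `σ`-hermitian when its kernel is**: `(W.map σ)ᵀ = W` from `(Han.map σ)ᵀ = Han` (the pairing blocks are `0∕1`). [cite: Dieudonne1971GroupesClassiques, Chap. I §11] -/
theorem transpose_map_wittFormOn (hHan : (Han.map σ)ᵀ = Han) : ((wittFormOn e Han).map σ)ᵀ = wittFormOn e Han := by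
  ext p q
  obtain ⟨x, rfl⟩ := e.surjective p
  obtain ⟨y, rfl⟩ := e.surjective q
  rw [Matrix.transpose_apply, Matrix.map_apply, wittFormOn_apply, wittFormOn_apply, e.symm_apply_apply, e.symm_apply_apply]
  have hite : ∀ c : Prop, ∀ [Decidable c], σ (if c then (1 : R) else 0) = if c then 1 else 0 := fun c _ => by
    split_ifs <;> simp
  rcases x with i | u | j <;> rcases y with i' | u' | j'
  · rw [wittForm_inl_inl, wittForm_inl_inl, map_zero]
  · rw [wittForm_inr_inl_inl, wittForm_inl_inr_inl, map_zero]
  · rw [wittForm_inr_inr_inl, wittForm_inl_inr_inr, hite]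
    by_cases h : j' = Fin.rev i
    · rw [if_pos h, if_pos (by rw [h, Fin.rev_rev])]
    · rw [if_neg h, if_neg (fun h' => h (by rw [h', Fin.rev_rev]))]
  · rw [wittForm_inl_inr_inl, wittForm_inr_inl_inl, map_zero]
  · rw [wittForm_inr_inl_inr_inl, wittForm_inr_inl_inr_inl]
    have h := congrFun (congrFun hHan u) u'
    rwa [Matrix.transpose_apply, Matrix.map_apply] at h
  · rw [wittForm_inr_inr_inr_inl, wittForm_inr_inl_inr_inr, map_zero]
  · rw [wittForm_inl_inr_inr, wittForm_inr_inr_inl, hite]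
    by_cases h : i' = Fin.rev j
    · rw [if_pos h, if_pos (by rw [h, Fin.rev_rev])]
    · rw [if_neg h, if_neg (fun h' => h (by rw [h', Fin.rev_rev]))]
  · rw [wittForm_inr_inl_inr_inr, wittForm_inr_inr_inr_inl, map_zero]
  · rw [wittForm_inr_inr_inr_inr, wittForm_inr_inr_inr_inr, map_zero]

end Pairing

/-! ## §2b Integrality of `W` and of `h_W` on `𝒪^N` -/

section Integral

variable {K : Type*} [Field K] [Valued K ℤᵐ⁰] (σ : K →+* K) {N r m : ℕ} (e : WittIndex r m ≃ Fin N) (Han : Matrix (Fin m) (Fin m) K)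

/-- **`W` is an integral matrix when its kernel is** (the other entries are `0` and `1`). [cite: Omeara1963, §82F] -/
theorem v_wittFormOn_apply_le_one (hint : ∀ u u', Valued.v (Han u u') ≤ 1) (p q : Fin N) : Valued.v (wittFormOn e Han p q) ≤ 1 := by
  obtain ⟨x, rfl⟩ := e.surjective p
  obtain ⟨y, rfl⟩ := e.surjective q
  rw [wittFormOn_apply, e.symm_apply_apply, e.symm_apply_apply]
  have hite : ∀ c : Prop, ∀ [Decidable c], Valued.v (if c then (1 : K) else 0) ≤ 1 := fun c _ => by
    split_ifs
    · rw [map_one]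
    · rw [map_zero]; exact zero_le
  rcases x with i | u | j <;> rcases y with i' | u' | j'
  · rw [wittForm_inl_inl, map_zero]; exact zero_le
  · rw [wittForm_inl_inr_inl, map_zero]; exact zero_le
  · rw [wittForm_inl_inr_inr]; exact hite _
  · rw [wittForm_inr_inl_inl, map_zero]; exact zero_le
  · rw [wittForm_inr_inl_inr_inl]; exact hint u u'
  · rw [wittForm_inr_inl_inr_inr, map_zero]; exact zero_le
  · rw [wittForm_inr_inr_inl]; exact hite _
  · rw [wittForm_inr_inr_inr_inl, map_zero]; exact zero_le
  · rw [wittForm_inr_inr_inr_inr, map_zero]; exact zero_le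

/-- **An integral form matrix is `𝒪`-valued on `𝒪^N × 𝒪^N`** (`σ` isometric). [cite: Omeara1963, §82F] -/
theorem v_hermForm_le_one_of_mem_stdLattice (hvσ : ∀ a, Valued.v (σ a) = Valued.v a) {H : Matrix (Fin N) (Fin N) K}
    (hH : ∀ p q, Valued.v (H p q) ≤ 1) {x y : Fin N → K} (hx : x ∈ stdLattice K N) (hy : y ∈ stdLattice K N) :
    Valued.v (hermForm σ H x y) ≤ 1 := by
  rw [hermForm_apply, dotProduct]
  refine Valuation.map_sum_le _ fun p _ => ?_
  rw [Function.comp_apply, map_mul, hvσ, Matrix.mulVec, dotProduct]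
  refine mul_le_one' (hx p) (Valuation.map_sum_le _ fun q _ => ?_)
  rw [map_mul]
  exact mul_le_one' (hH p q) (hy q)

/-- `h_W` is `𝒪`-valued on `𝒪^N × 𝒪^N` when the kernel `Han` is integral. [cite: Omeara1963, §82F] -/
theorem v_hermForm_witt_le_one (hvσ : ∀ a, Valued.v (σ a) = Valued.v a) (hint : ∀ u u', Valued.v (Han u u') ≤ 1) {x y : Fin N → K}
    (hx : x ∈ stdLattice K N) (hy : y ∈ stdLattice K N) : Valued.v (hermForm σ (wittFormOn e Han) x y) ≤ 1 :=
  v_hermForm_le_one_of_mem_stdLattice σ hvσ (v_wittFormOn_apply_le_one e Han hint) hx hy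

omit [Valued K ℤᵐ⁰] in
/-- Rescaling keeps isotropy: `h(c x, c x) = σ(c) c h(x, x)`. [cite: Omeara1963, §42D] -/
theorem hermForm_smul_smul_self_eq_zero {n : Type*} [Fintype n] [DecidableEq n] (H : Matrix n n K) {x : n → K} (hx : hermForm σ H x x = 0) (c : K) :
    hermForm σ H (c • x) (c • x) = 0 := by
  rw [hermForm_smul_left_eq, hermForm_smul_right, hx, mul_zero, mul_zero]

end Integral

/-! ## §3 A primitive isotropic vector has a unit HYPERBOLIC coordinate (normalised kernel) -/

section Primitive

variable {K : Type*} [Field K] [Valued K ℤᵐ⁰] (σ : K →+* K) {N r m : ℕ} (e : WittIndex r m ≃ Fin N)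
  (hstd : ∀ x, (e x).val = Sum.elim (fun i : Fin r => i.val) (Sum.elim (fun u : Fin m => r + u.val) (fun j : Fin r => r + m + j.val)) x)
  (Han : Matrix (Fin m) (Fin m) K)

include hstd in
/-- **A PRIMITIVE ISOTROPIC VECTOR OF `𝒪^N` HAS A UNIT COORDINATE AT A HYPERBOLIC POSITION** (normalised kernel).  Hypotheses: `v ∘ σ = v`, a uniformiser
`ϖ` (`v ϖ = exp (−1)`), and `hmax`: `|h_an(z, z)| ≤ 1 → z ∈ 𝒪^m` (the maximal lattice of the anisotropic kernel is `𝒪^m`, ★ p856519).  If every hyperbolic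
coordinate of the integral isotropic `x` had valuation `< 1`, i.e. `≤ |ϖ|`, then by the split `h_W(x,x) = (hyperbolic part) + h_an(x_mid, x_mid) = 0` we
would get `|h_an(x_mid, x_mid)| ≤ |ϖ|²`, hence `|h_an(ϖ⁻¹ x_mid, ϖ⁻¹ x_mid)| ≤ 1`, `ϖ⁻¹ x_mid ∈ 𝒪^m`, and EVERY coordinate of `x` would lie in `𝔭` —
contradicting the unit coordinate. [cite: Omeara1963, §82F, §91A] [cite: Jacobowitz1962, §4] [cite: BruhatTits1972, (4.4.3)] -/
theorem exists_v_eq_one_hyperbolic (hvσ : ∀ a, Valued.v (σ a) = Valued.v a) {ϖ : K} (hϖ : Valued.v ϖ = WithZero.exp (-1 : ℤ))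
    (hmax : ∀ z : Fin m → K, Valued.v (hermForm σ Han z z) ≤ 1 → z ∈ stdLattice K m)
    {x : Fin N → K} (hx : x ∈ stdLattice K N) (hunit : ∃ j, Valued.v (x j) = 1) (hiso : hermForm σ (wittFormOn e Han) x x = 0) :
    ∃ a : Fin N, (a.val < r ∨ r + m ≤ a.val) ∧ Valued.v (x a) = 1 := by
  by_contra H
  push Not at H
  have hϖ0 : ϖ ≠ 0 := fun h0 => by rw [h0, map_zero] at hϖ; exact WithZero.coe_ne_zero hϖ.symm
  -- every hyperbolic coordinate lies in `𝔭 = ϖ𝒪`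
  have hlt : ∀ a : Fin N, (a.val < r ∨ r + m ≤ a.val) → Valued.v (x a) ≤ Valued.v ϖ := fun a ha => by
    rw [hϖ]; exact (v_lt_one_iff _).1 (lt_of_le_of_ne (hx a) (H a ha))
  -- the hyperbolic part of `h_W(x,x)` has valuation `≤ |ϖ|²`
  have hhyp : Valued.v (∑ i : Fin r, (σ (x (e (Sum.inl i))) * x (Fin.rev (e (Sum.inl i))) +
      σ (x (e (Sum.inr (Sum.inr i)))) * x (Fin.rev (e (Sum.inr (Sum.inr i)))))) ≤ Valued.v ϖ * Valued.v ϖ := by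
    refine Valuation.map_sum_le _ fun i _ => (Valuation.map_add _ _ _).trans (max_le ?_ ?_)
    · rw [map_mul, hvσ]
      exact mul_le_mul' (hlt _ (apply_inl_hyperbolic e hstd i)) (hlt _ (rev_hyperbolic e (apply_inl_hyperbolic e hstd i)))
    · rw [map_mul, hvσ]
      exact mul_le_mul' (hlt _ (apply_inr_inr_hyperbolic e hstd i)) (hlt _ (rev_hyperbolic e (apply_inr_inr_hyperbolic e hstd i)))
  -- hence so has `h_an(x_mid, x_mid)`
  have hsplit := hermForm_witt_eq_sum_add σ e hstd Han x x
  rw [hiso] at hsplit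
  have han : Valued.v (hermForm σ Han (fun u => x (e (Sum.inr (Sum.inl u)))) (fun u => x (e (Sum.inr (Sum.inl u))))) ≤ Valued.v ϖ * Valued.v ϖ := by
    have h := (eq_neg_of_add_eq_zero_right hsplit.symm)
    rw [h, Valuation.map_neg]
    exact hhyp
  -- so `ϖ⁻¹ x_mid ∈ 𝒪^m`
  have hmid : (ϖ⁻¹ • fun u => x (e (Sum.inr (Sum.inl u)))) ∈ stdLattice K m := by
    refine hmax _ ?_
    rw [hermForm_smul_left_eq, hermForm_smul_right, map_mul, map_mul, hvσ, map_inv₀]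
    have hv0 : Valued.v ϖ ≠ 0 := (Valuation.ne_zero_iff _).2 hϖ0
    calc (Valued.v ϖ)⁻¹ * ((Valued.v ϖ)⁻¹ * Valued.v (hermForm σ Han (fun u => x (e (Sum.inr (Sum.inl u)))) fun u => x (e (Sum.inr (Sum.inl u)))))
        ≤ (Valued.v ϖ)⁻¹ * ((Valued.v ϖ)⁻¹ * (Valued.v ϖ * Valued.v ϖ)) := mul_le_mul' le_rfl (mul_le_mul' le_rfl han)
      _ = 1 := by rw [inv_mul_cancel_left₀ hv0, inv_mul_cancel₀ hv0]
  -- every coordinate of `x` lies in `𝔭`: contradiction with the unit coordinate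
  obtain ⟨j, hj⟩ := hunit
  have hj' : Valued.v (x j) < 1 := by
    by_cases hjh : j.val < r ∨ r + m ≤ j.val
    · exact lt_of_le_of_ne (hx j) (H j hjh)
    · have h₁ : r ≤ j.val := by omega
      have h₂ : j.val < r + m := by omega
      have hmem := hmid ⟨j.val - r, by omega⟩
      rw [Pi.smul_apply, smul_eq_mul, map_mul, map_inv₀] at hmem
      have hcoord : e (Sum.inr (Sum.inl ⟨j.val - r, by omega⟩)) = j := (eq_apply_inr_inl_of e hstd h₁ h₂).symm
      rw [hcoord] at hmem
      have hv0 : Valued.v ϖ ≠ 0 := (Valuation.ne_zero_iff _).2 hϖ0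
      have h3 : Valued.v (x j) ≤ Valued.v ϖ := by
        have := mul_le_mul' (le_refl (Valued.v ϖ)) hmem
        rwa [← mul_assoc, mul_inv_cancel₀ hv0, one_mul, mul_one] at this
      exact lt_of_le_of_lt h3 (by rw [hϖ, ← WithZero.exp_zero, WithZero.exp_lt_exp]; norm_num)
  rw [hj] at hj'
  exact lt_irrefl _ hj'

end Primitive

end Summit.HodgeConjecture.HodgeConjecture.Cruxes.H413.K2E3WittHermFormStd

end
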